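import Literature.Analysis.FluidPDE.FluidComputer.DyadicInterval
import Mathlib.Analysis.SpecialFunctions.Pow.Real
import Mathlib.Tactic.Linarith
import Mathlib.Tactic.Positivity
import Mathlib.Tactic.Ring
import HarnessLib

/-!
# The 2D control: a kernel-fast interval arithmetic for the `₂F₁`-valued obligations (C) and (M)
(cell `pub-ising3x`, seat controls-1; arithmetic layer of the kernel checkers for obligations (M) and (C))

HONEST FRAMING: lottery ticket; floor = tightest certified 3D Ising CFT bounds; no exact-solution
claim without a proof.

The obligations (C) (`Δ`-cells below `E₀`) and (M) (pair monomials `E₀ ≤ a + b < Δ⋆`) of a 2D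
point-functional certificate are families of inequalities in a REAL parameter; the two interval
verifiers decide them with dyadic interval arithmetic. This file is the arithmetic the Lean KERNEL
evaluates for the same purpose (`decide +kernel`):

* `NI` — intervals of NON-NEGATIVE reals with natural-number ends at precision `P`
  (`NI.mem P I x : I.lo ≤ x·2^P ≤ I.hi`): `add`, `subT` (truncated difference of an ordered pair),
  `mul` (ONE product per end — every block-side quantity of the two schemes is non-negative; the
  signed combinations are taken at the very end, in `ℤ`, on the integer ends), `mulNat`, `divNat`,
  `ofNatFrac`/`ofRat`, `sqrt` (the CHECKED integer square roots of the tree's `DyadicInterval.lean`),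
  `powN`, `sqrtIter`, and the test `leB`; every operation comes with its inclusion theorem.

Design (measured on the farm, 2026-08-20): the kernel's GMP fast path covers `ℕ` literals
(`Nat.add/mul/div/pow/…`); `(2 : ℤ) ^ P`, `-x` and `min`/`max` on `ℤ` through generic instances cost
milliseconds per call in `whnf`, and the tree's four-product `DI.mul` (with `Numerics.cdiv`) ≈ 15 ms
against ≈ 0.05 ms for `NI.mul` below; so the hot loops of the checkers are `ℕ`-only and force
evaluation once per loop step (a data-dependent branch), and `DI` is used only for `sqrtLoNat` /
`sqrtHiNat`.

References: R. E. Moore, *Interval Analysis* (1966), Ch. 2 (inclusion isotonicity, outward rounding)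
[folklore]; tree: `Literature/Analysis/FluidPDE/FluidComputer/DyadicInterval.lean` (`sqrtLoNat`,
`sqrtHiNat`, the pattern of `DI.mem`).
-/

namespace Summit.CriticalPhenomena.Ising3D.Control2D

open Literature.Analysis.FluidPDE.FluidComputer (DI)

/-! ### Non-negative intervals with natural-number ends -/

/-- An interval of non-negative reals at precision `P`: naturals `lo, hi` denoting
`[lo / 2^P, hi / 2^P]`. [folklore] -/
structure NI where
  /-- scaled lower end -/
  lo : ℕ
  /-- scaled upper end -/
  hi : ℕ
  deriving DecidableEq, Repr

namespace NI

/-- Membership of a real number in an `NI` at precision `P`. [folklore] -/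
def mem (P : ℕ) (I : NI) (x : ℝ) : Prop := (I.lo : ℝ) ≤ x * 2 ^ P ∧ x * 2 ^ P ≤ (I.hi : ℝ)

/-- A member of an `NI` is non-negative. [folklore] -/
theorem nonneg_of_mem {P : ℕ} {I : NI} {x : ℝ} (hx : I.mem P x) : 0 ≤ x := by
  have h2 : (0 : ℝ) < 2 ^ P := pow_pos two_pos P
  have h0 : (0 : ℝ) ≤ (I.lo : ℝ) := Nat.cast_nonneg _
  nlinarith [hx.1]

/-- Ceiling division of naturals (`n > 0`). [folklore] -/
def cdivN (a n : ℕ) : ℕ := (a + n - 1) / n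

/-- `a ≤ ⌈a/n⌉·n`. [folklore] -/
theorem le_cdivN_mul {a n : ℕ} (hn : 0 < n) : a ≤ cdivN a n * n := by
  unfold cdivN
  have h1 := Nat.div_add_mod (a + n - 1) n
  have h2 := Nat.mod_lt (a + n - 1) hn
  have h3 : n * ((a + n - 1) / n) = a + n - 1 - (a + n - 1) % n := by omega
  have h4 : a ≤ a + n - 1 - (a + n - 1) % n := by omega
  rw [mul_comm]
  omega

/-- `a/n ≤ ⌈a/n⌉` read in `ℝ`. [folklore] -/
theorem div_le_cdivN {a n : ℕ} (hn : 0 < n) : (a : ℝ) / n ≤ (cdivN a n : ℝ) := by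
  have hn' : (0 : ℝ) < n := by exact_mod_cast hn
  rw [div_le_iff₀ hn']
  exact_mod_cast le_cdivN_mul (a := a) hn

/-- The point interval of `1`. [folklore] -/
def one (P : ℕ) : NI := ⟨2 ^ P, 2 ^ P⟩

/-- [folklore] -/
theorem mem_one (P : ℕ) : (one P).mem P 1 := by
  simp only [mem, one, one_mul, Nat.cast_pow, Nat.cast_ofNat]
  exact ⟨le_rfl, le_rfl⟩

/-- The point interval of `0`. [folklore] -/
def zero : NI := ⟨0, 0⟩

/-- [folklore] -/
theorem mem_zero (P : ℕ) : zero.mem P 0 := by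
  simp [mem, zero]

/-- Sum. [folklore] -/
def add (I J : NI) : NI := ⟨I.lo + J.lo, I.hi + J.hi⟩

/-- [folklore] -/
theorem mem_add {P : ℕ} {I J : NI} {x y : ℝ} (hx : I.mem P x) (hy : J.mem P y) :
    (I.add J).mem P (x + y) := by
  obtain ⟨h1, h2⟩ := hx; obtain ⟨h3, h4⟩ := hy
  simp only [mem, add, Nat.cast_add]
  constructor <;> linarith

/-- Truncated difference: encloses `x - y` for members `x ≥ y` (lower end clipped at `0` by `ℕ`
subtraction). [folklore] -/
def subT (I J : NI) : NI := ⟨I.lo - J.hi, I.hi - J.lo⟩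

/-- [folklore] -/
theorem mem_subT {P : ℕ} {I J : NI} {x y : ℝ} (hx : I.mem P x) (hy : J.mem P y) (hyx : y ≤ x) :
    (I.subT J).mem P (x - y) := by
  obtain ⟨h1, h2⟩ := hx; obtain ⟨h3, h4⟩ := hy
  have h2P : (0 : ℝ) < 2 ^ P := pow_pos two_pos P
  have hXY : y * 2 ^ P ≤ x * 2 ^ P := mul_le_mul_of_nonneg_right hyx h2P.le
  simp only [mem, subT, sub_mul]
  constructor
  · rcases le_or_gt J.hi I.lo with hle | hlt
    · rw [Nat.cast_sub hle]; linarith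
    · rw [Nat.sub_eq_zero_of_le hlt.le, Nat.cast_zero]; linarith
  · rcases le_or_gt J.lo I.hi with hle | hlt
    · rw [Nat.cast_sub hle]; linarith
    · rw [Nat.sub_eq_zero_of_le hlt.le, Nat.cast_zero]
      have : (I.hi : ℝ) < J.lo := by exact_mod_cast hlt
      linarith

/-- Product at precision `P`: ONE product per end (members are non-negative), floor / ceiling
rescaling by `2^P`. [folklore] -/
def mul (P : ℕ) (I J : NI) : NI := ⟨I.lo * J.lo / 2 ^ P, cdivN (I.hi * J.hi) (2 ^ P)⟩

/-- [folklore] -/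
theorem mem_mul {P : ℕ} {I J : NI} {x y : ℝ} (hx : I.mem P x) (hy : J.mem P y) :
    (I.mul P J).mem P (x * y) := by
  obtain ⟨h1, h2⟩ := hx; obtain ⟨h3, h4⟩ := hy
  have h2P : (0 : ℝ) < 2 ^ P := pow_pos two_pos P
  have hlo1 : (0 : ℝ) ≤ (I.lo : ℝ) := Nat.cast_nonneg _
  have hlo2 : (0 : ℝ) ≤ (J.lo : ℝ) := Nat.cast_nonneg _
  have hX : 0 ≤ x * 2 ^ P := hlo1.trans h1
  have hY : 0 ≤ y * 2 ^ P := hlo2.trans h3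
  have hval : x * y * 2 ^ P = (x * 2 ^ P) * (y * 2 ^ P) / 2 ^ P := by field_simp
  simp only [mem, mul, hval]
  constructor
  · have hf : ((I.lo * J.lo / 2 ^ P : ℕ) : ℝ) ≤ ((I.lo * J.lo : ℕ) : ℝ) / ((2 ^ P : ℕ) : ℝ) :=
      Nat.cast_div_le
    push_cast at hf
    refine hf.trans (div_le_div_of_nonneg_right ?_ h2P.le)
    exact mul_le_mul h1 h3 hlo2 hX
  · have hc := div_le_cdivN (a := I.hi * J.hi) (n := 2 ^ P) (pow_pos two_pos P)
    push_cast at hc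
    refine (div_le_div_of_nonneg_right ?_ h2P.le).trans hc
    exact mul_le_mul h2 h4 hY (hX.trans h2)

/-- Scaling by a natural number (exact). [folklore] -/
def mulNat (n : ℕ) (I : NI) : NI := ⟨n * I.lo, n * I.hi⟩

/-- [folklore] -/
theorem mem_mulNat {P : ℕ} (n : ℕ) {I : NI} {x : ℝ} (hx : I.mem P x) :
    (I.mulNat n).mem P ((n : ℝ) * x) := by
  obtain ⟨h1, h2⟩ := hx
  have hn : (0 : ℝ) ≤ n := Nat.cast_nonneg n
  simp only [mem, mulNat, Nat.cast_mul, mul_assoc]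
  exact ⟨mul_le_mul_of_nonneg_left h1 hn, mul_le_mul_of_nonneg_left h2 hn⟩

/-- Division by a positive natural number (floor / ceiling). [folklore] -/
def divNat (n : ℕ) (I : NI) : NI := ⟨I.lo / n, cdivN I.hi n⟩

/-- [folklore] -/
theorem mem_divNat {P : ℕ} {n : ℕ} (hn : 0 < n) {I : NI} {x : ℝ} (hx : I.mem P x) :
    (I.divNat n).mem P (x / n) := by
  obtain ⟨h1, h2⟩ := hx
  have hn' : (0 : ℝ) < n := by exact_mod_cast hn
  have hval : x / n * 2 ^ P = (x * 2 ^ P) / n := by ring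
  simp only [mem, divNat, hval]
  constructor
  · exact (Nat.cast_div_le.trans (div_le_div_of_nonneg_right h1 hn'.le))
  · exact (div_le_div_of_nonneg_right h2 hn'.le).trans (div_le_cdivN hn)

/-- Enclosure of a fraction of naturals `num / den` (`den > 0`; exact numerator and denominator,
e.g. `Nat.pow` powers of the coordinates, rounded ONCE). [folklore] -/
def ofNatFrac (P num den : ℕ) : NI := ⟨num * 2 ^ P / den, cdivN (num * 2 ^ P) den⟩

/-- [folklore] -/
theorem mem_ofNatFrac (P : ℕ) {num den : ℕ} (hden : 0 < den) :
    (ofNatFrac P num den).mem P ((num : ℝ) / den) := by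
  have hden' : (0 : ℝ) < den := by exact_mod_cast hden
  have hval : (num : ℝ) / den * 2 ^ P = ((num * 2 ^ P : ℕ) : ℝ) / den := by
    push_cast; ring
  simp only [mem, ofNatFrac, hval]
  exact ⟨Nat.cast_div_le, div_le_cdivN hden⟩

/-- Enclosure of a non-negative rational. [folklore] -/
def ofRat (P : ℕ) (q : ℚ) : NI := ofNatFrac P q.num.toNat q.den

/-- [folklore] -/
theorem mem_ofRat (P : ℕ) {q : ℚ} (hq : 0 ≤ q) : (ofRat P q).mem P (q : ℝ) := by
  have hnum : (q.num.toNat : ℤ) = q.num := Int.toNat_of_nonneg (Rat.num_nonneg.mpr hq)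
  have hnumR : ((q.num.toNat : ℕ) : ℝ) = (q.num : ℝ) := by exact_mod_cast hnum
  have hval : (q : ℝ) = ((q.num.toNat : ℕ) : ℝ) / q.den := by rw [hnumR, Rat.cast_def]
  rw [hval]
  exact mem_ofNatFrac P q.den_pos

/-- Square root at precision `P`: `√x · 2^P = √((x·2^P)·2^P)`, bracketed by the CHECKED integer
square roots of the tree's `DyadicInterval.lean`. [folklore] -/
def sqrt (P : ℕ) (I : NI) : NI := ⟨DI.sqrtLoNat (I.lo * 2 ^ P), DI.sqrtHiNat (I.hi * 2 ^ P)⟩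

/-- [folklore] -/
theorem mem_sqrt {P : ℕ} {I : NI} {x : ℝ} (hx : I.mem P x) : (I.sqrt P).mem P (Real.sqrt x) := by
  obtain ⟨h1, h2⟩ := hx
  have h2P : (0 : ℝ) < 2 ^ P := pow_pos two_pos P
  have hval : Real.sqrt x * 2 ^ P = Real.sqrt (x * 2 ^ P * 2 ^ P) := by
    rw [mul_assoc, ← pow_two, Real.sqrt_mul' x (by positivity), Real.sqrt_sq h2P.le]
  simp only [mem, sqrt, hval]
  constructor
  · set N := I.lo * 2 ^ P with hN
    have hr := DI.sqrtLoNat_mul_self_le N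
    apply Real.le_sqrt_of_sq_le
    have hr' : ((DI.sqrtLoNat N : ℕ) : ℝ) ^ 2 ≤ (N : ℝ) := by rw [pow_two]; exact_mod_cast hr
    refine hr'.trans ?_
    rw [hN]; push_cast
    exact mul_le_mul_of_nonneg_right h1 h2P.le
  · set N := I.hi * 2 ^ P with hN
    have hR := DI.lt_sqrtHiNat_mul_self N
    have hR1 : 0 < DI.sqrtHiNat N := by
      rcases Nat.eq_zero_or_pos (DI.sqrtHiNat N) with h | h
      · rw [h] at hR; simp at hR
      · exact h
    have hR1' : (0 : ℝ) < (DI.sqrtHiNat N : ℕ) := by exact_mod_cast hR1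
    apply le_of_lt
    rw [Real.sqrt_lt' hR1']
    have hR' : (N : ℝ) < ((DI.sqrtHiNat N : ℕ) : ℝ) ^ 2 := by rw [pow_two]; exact_mod_cast hR
    refine lt_of_le_of_lt ?_ hR'
    rw [hN]; push_cast
    exact mul_le_mul_of_nonneg_right h2 h2P.le

/-- Natural powers by repeated multiplication. [folklore] -/
def powN (P : ℕ) (I : NI) : ℕ → NI
  | 0 => one P
  | n + 1 => (powN P I n).mul P I

/-- [folklore] -/
theorem mem_powN {P : ℕ} {I : NI} {x : ℝ} (hx : I.mem P x) : ∀ n : ℕ, (I.powN P n).mem P (x ^ n)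
  | 0 => by rw [pow_zero]; exact mem_one P
  | n + 1 => by rw [pow_succ]; exact mem_mul (mem_powN hx n) hx

/-- Iterated square root: `sqrtIter P k I ∋ x^(1/2^k)`. [folklore] -/
def sqrtIter (P : ℕ) : ℕ → NI → NI
  | 0, I => I
  | k + 1, I => (sqrtIter P k I).sqrt P

/-- [folklore] -/
theorem mem_sqrtIter {P : ℕ} {I : NI} {x : ℝ} (hx0 : 0 ≤ x) (hx : I.mem P x) :
    ∀ k : ℕ, (sqrtIter P k I).mem P (x ^ ((1 : ℝ) / 2 ^ k))
  | 0 => by simpa [sqrtIter] using hx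
  | k + 1 => by
    have h := mem_sqrt (mem_sqrtIter hx0 hx k)
    have e : Real.sqrt (x ^ ((1 : ℝ) / 2 ^ k)) = x ^ ((1 : ℝ) / 2 ^ (k + 1)) := by
      rw [Real.sqrt_eq_rpow, ← Real.rpow_mul hx0]
      congr 1
      rw [pow_succ]; field_simp
    rw [e] at h
    exact h

/-- The sign tests. [folklore] -/
def leB (I J : NI) : Bool := decide (I.hi ≤ J.lo)

/-- [folklore] -/
theorem le_of_leB {P : ℕ} {I J : NI} {x y : ℝ} (h : leB I J = true) (hx : I.mem P x)
    (hy : J.mem P y) : x ≤ y := by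
  have h2P : (0 : ℝ) < 2 ^ P := pow_pos two_pos P
  have hIJ : I.hi ≤ J.lo := of_decide_eq_true h
  have hIJ' : (I.hi : ℝ) ≤ J.lo := by exact_mod_cast hIJ
  nlinarith [hx.2, hy.1]

end NI

end Summit.CriticalPhenomena.Ising3D.Control2D
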